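import Summits.QuantumAdvantage.QuantumAdvantage.Theorems.WbwObfuscatedGluedTreesKowBbVocabulary

/-!
# The generator's naming is the ideal SIV naming of its own two tables

Stage 5 (black-box soundness) of the knowledge-of-walk split audits the obfuscated glued-trees
generator in an IDEAL model in which the two PRF instances of the vertex naming — the tag
`ℓ ↦ F_{k₁}(ℓ)` of a label and the mask `τ ↦ F_{k₂}(τ)` of a tag — are replaced by random tables.
This file identifies what is idealised: the generator's naming `naming P μ k₁ k₂ d` IS the ideal
SIV naming `sivNaming T Mk` of its own two tables `T = tagTableOf P μ k₁ d` and
`Mk = maskTableOf P μ k₂ d` (`naming_eq_sivNaming_tables`, registered as `stub_namingTables`).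

The proof lists both bit vectors back to strings (`List.ofFn` is injective at a fixed length):
the generator's name lists to `name_k(v) = τ ++ (label v ⊕ F_{k₂}(τ))`, `τ = F_{k₁}(label v)`
(`ofFn_naming`), and the ideal name `T(label v) ++ (label v ⊕ Mk (T (label v)))` lists to the
same string once the tables are read off the scheme.
-/

set_option linter.dupNamespace false

namespace Summit.QuantumAdvantage.QuantumAdvantage.Theorems.WbwObfuscatedGluedTrees.KnowledgeOfWalk.BlackBox

open Literature.Computability.Complexity Literature.Computability.QuantumComplexity
open Literature.Computability.QuantumComplexity.GluedTrees
open Literature.Computability.Cryptography Literature.Computability.Cryptography.ObfuscatedGluedTrees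

variable {d μ : ℕ}

/-- Re-indexing a string of known length `m` by `Fin m` and listing it gives the string back. -/
theorem ofFn_get_cast {l : List Bool} {m : ℕ} (h : l.length = m) :
    List.ofFn (fun i : Fin m => l.get (i.cast h.symm)) = l := by
  subst h
  simp

/-- Listing the bitwise xor of two bit vectors gives the bitwise xor of the listed strings. -/
theorem ofFn_xorVec {m : ℕ} (a b : Fin m → Bool) :
    List.ofFn (xorVec a b) = bxor (List.ofFn a) (List.ofFn b) := by
  apply List.ext_get (by simp) fun i h₁ h₂ => ?_
  simp [xorVec, bxor]

/-- Listing a row of the tag table of a scheme and a key: `T(ℓ)` lists to `F_{k₁}(ℓ)` fitted to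
`μ` bits. -/
theorem ofFn_tagTableOf (P : PuncturablePRFScheme) (μ : ℕ) (k₁ : List Bool) (d : ℕ)
    (ℓ : Fin (labelLen d) → Bool) :
    List.ofFn (tagTableOf P μ k₁ d ℓ) = prf P μ k₁ μ (List.ofFn ℓ) :=
  ofFn_get_cast (length_prf P μ k₁ μ (List.ofFn ℓ))

/-- Listing a row of the mask table of a scheme and a key: `Mk(τ)` lists to `F_{k₂}(τ)` fitted to
`2d + 3` bits. -/
theorem ofFn_maskTableOf (P : PuncturablePRFScheme) (μ : ℕ) (k₂ : List Bool) (d : ℕ)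
    (τ : Fin μ → Bool) :
    List.ofFn (maskTableOf P μ k₂ d τ) = prf P μ k₂ (labelLen d) (List.ofFn τ) :=
  ofFn_get_cast (length_prf P μ k₂ (labelLen d) (List.ofFn τ))

/-- Listing an ideal SIV name: the listed tag followed by the listed masked label. -/
theorem ofFn_sivName (T : TagTable d μ) (Mk : MaskTable d μ) (v : Vertex d) :
    List.ofFn (sivName T Mk v) =
      List.ofFn (T (labelVec d v)) ++ List.ofFn (xorVec (labelVec d v) (Mk (T (labelVec d v)))) :=
  List.ofFn_fin_append _ _

/-- The ideal SIV name of a vertex from the tables of a scheme and two keys lists to the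
generator's name string `name_k(v)`. -/
theorem ofFn_sivName_tables (P : PuncturablePRFScheme) (μ : ℕ) (k₁ k₂ : List Bool) (d : ℕ)
    (v : Vertex d) :
    List.ofFn (sivName (tagTableOf P μ k₁ d) (maskTableOf P μ k₂ d) v) = vname P μ k₁ k₂ d v := by
  rw [ofFn_sivName, ofFn_xorVec, ofFn_maskTableOf, ofFn_tagTableOf, ofFn_labelVec, vname, sivEnc,
    tag, length_label]

/-- **The generator's naming is the ideal SIV naming of its own two tables** `ℓ ↦ F_{k₁}(ℓ)` and
`τ ↦ F_{k₂}(τ)`: the idealisation of stage 5 replaces exactly these two tables by random ones. -/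
theorem naming_eq_sivNaming_tables (P : PuncturablePRFScheme) (μ : ℕ) (k₁ k₂ : List Bool)
    (d : ℕ) : naming P μ k₁ k₂ d = sivNaming (tagTableOf P μ k₁ d) (maskTableOf P μ k₂ d) := by
  refine Function.Embedding.ext fun v => List.ofFn_injective ?_
  rw [ofFn_naming, sivNaming_apply, ofFn_sivName_tables]

/-- **Stub `stub_namingTables`** (what the ideal model idealises): the generator's naming is the
ideal SIV naming of its own two tables `ℓ ↦ F_{k₁}(ℓ)` and `τ ↦ F_{k₂}(τ)`. -/
theorem stub_namingTables : ∀ (P : PuncturablePRFScheme) (μ : ℕ) (k₁ k₂ : List Bool) (d : ℕ),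
    naming P μ k₁ k₂ d = sivNaming (tagTableOf P μ k₁ d) (maskTableOf P μ k₂ d) :=
  naming_eq_sivNaming_tables

end Summit.QuantumAdvantage.QuantumAdvantage.Theorems.WbwObfuscatedGluedTrees.KnowledgeOfWalk.BlackBox
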